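import Summits.ValiantsHypothesis.ValiantsHypothesis.Theses.DivisionGap
import Summits.ValiantsHypothesis.ValiantsHypothesis.Theorems.ShadowBirkhoff.Negative.Pencils
import Literature.Computability.AlgebraicComplexity.BirkhoffShadowLowerBound

/-!
# `DivisionGap.ShadowBirkhoff` (stmt-ValiantsHypothesis-5069): the path world is capped —
Gusfield's bound for uniquely cheapest walks in layered graphs (negative knowledge)

The crux `ShadowBirkhoff` asks for super-quasi-polynomially many vertices of a planar shadow of the
Birkhoff polytope `DS_n`.  The tree's lower bound `2^{(log₂ n)²/100} ≤ σ(DS_n)`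
(`Literature/Computability/AlgebraicComplexity/BirkhoffShadowLowerBound.lean`) realises the
uniquely-cheapest walks of a layered DAG (Carstensen; Mulmuley–Shah; Gajjar–Radhakrishnan) as
uniquely supported vertices of a face of `DS_ν` (`BirkhoffShadowLower.embed`, `core`).  This file
proves that this source is exhausted at quasi-polynomial, i.e. Gusfield's matching upper bound for
parametric shortest paths, in the same vocabulary (`Layer`, `IsWalk`, `cost`, `endpt`, `eval`):

* `UC G b e` — the `b → e` walks through the layered graph `G` that are the UNIQUE cheapest
  `b → e` walk for some parameter `t` (affine arc costs `c + t·d`);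
* `UC_append_subset`, `ncard_UC_append_le` — midpoint recursion: a uniquely cheapest walk through
  `G₁ ++ G₂` splits at the middle layer into two uniquely cheapest half-walks supported at a common
  `t`; for a fixed middle row the two families of parameter intervals are pairwise disjoint, so they
  have at most `|UC₁| + |UC₂|` meeting pairs (the interval-counting lemma
  `HrubesYehudayoff2021Prop23.ncard_meeting_pairs_le` of the HY21 upper-bound file);
* `costPts_append_eq`, `ncard_um_costPts_le`, `ncard_extremePoints_costPolygon_le` — the same at
  the level of cost POINTS (ties allowed): the cost points of `G₁ ++ G₂` are the union over middle
  rows of Minkowski sums of half cost points, so every pencil supports uniquely at most `(2n)^k` of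
  them and the shadow polygon of the path polytope under ANY planar arc weighting has at most
  `4·(2n)^k` vertices (`σ(path polytope) ≤ 4(2n)^k`);
* `ncard_UC_le` — **Gusfield's cap** (walk level): with at most `2^k` layers entering rows `< n` (`n ≥ 1`),
  `|UC G b e| ≤ (2n)^k` for all `b, e` — the upper half of HY21 Prop. 22, `σ(CONN_n) = 2^{Θ(log² n)}`
  (p. 9:10: "The following proposition can be found in [8, 37]", i.e. Carstensen 1983 and
  Mulmuley–Shah 2001), here for arbitrary layered graphs.

Consequence for the crux (informal; the other three pencils of
`HrubesYehudayoff2021Prop23.extremePoints_subset_um4` are the same statement for negated/swapped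
weights): a witness of `ShadowBirkhoff` assembled from layered-DAG walks with `m` layers of width
`n` inside `DS_ν`, `ν ≥ m·n`, has at most `4·n·(2n)^{⌈log₂ m⌉} = ν^{O(log ν)}` vertices.  Any proof
must use perfect matchings with genuinely cyclic structure; any disproof must extend the interval
recursion beyond paths.  [Gusfield 1980 (thesis), Carstensen 1983; folklore form]
-/

noncomputable section

open scoped Pointwise

namespace Summit.ValiantsHypothesis.Theorems.ShadowBirkhoffNegative

open Literature.Computability.AlgebraicComplexity
open Literature.Computability.AlgebraicComplexity.BirkhoffShadowLower

/-- Parameters `t` at which `p` is strictly cheaper than every other `b → e` walk through `G`.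
[folklore] -/
def cheapParams (G : List Layer) (b e : ℕ) (p : List ℕ) : Set ℝ :=
  {t | ∀ q, IsWalk G b q → endpt b q = e → q ≠ p → eval (cost G b p) t < eval (cost G b q) t}

/-- The `b → e` walks through `G` that are the unique cheapest `b → e` walk for some parameter.
[folklore] -/
def UC (G : List Layer) (b e : ℕ) : Set (List ℕ) :=
  {p | IsWalk G b p ∧ endpt b p = e ∧ (cheapParams G b e p).Nonempty}

/-- The parameter set of a walk is an interval (affine costs). [folklore] -/
theorem ordConnected_cheapParams (G : List Layer) (b e : ℕ) (p : List ℕ) :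
    (cheapParams G b e p).OrdConnected := by
  refine ⟨fun t₁ ht₁ t₂ ht₂ t ht q hq hqe hqp => ?_⟩
  have h1 := ht₁ q hq hqe hqp
  have h2 := ht₂ q hq hqe hqp
  simp only [eval] at h1 h2 ⊢
  have ht1 : t₁ ≤ t := ht.1
  have ht2 : t ≤ t₂ := ht.2
  rcases le_total (cost G b p).2 (cost G b q).2 with h | h
  · nlinarith [mul_le_mul_of_nonneg_left h (sub_nonneg.2 ht1)]
  · nlinarith [mul_le_mul_of_nonneg_left h (sub_nonneg.2 ht2)]

/-- Two distinct `b → e` walks are never uniquely cheapest at the same parameter. [folklore] -/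
theorem cheapParams_disjoint (G : List Layer) (b e : ℕ) {p p' : List ℕ} (hp : p ∈ UC G b e)
    (hp' : p' ∈ UC G b e) (t : ℝ) (ht : t ∈ cheapParams G b e p) (ht' : t ∈ cheapParams G b e p') :
    p = p' := by
  by_contra h
  exact lt_asymm (ht p' hp'.1 hp'.2.1 (Ne.symm h)) (ht' p hp.1 hp.2.1 h)

/-- Rows visited by a walk are targets of arcs, hence `< n` if all arcs enter rows `< n`.
[folklore] -/
theorem forall_lt_of_isWalk {n : ℕ} : ∀ {G : List Layer} {b : ℕ} {p : List ℕ},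
    (∀ l ∈ G, ∀ x y, l.adj x y → y < n) → IsWalk G b p → ∀ x ∈ p, x < n
  | [], _, [], _, _ => by simp
  | [], _, _ :: _, _, h => h.elim
  | _ :: _, _, [], _, _ => by simp
  | l :: G, b, r :: rs, hG, h => by
    intro x hx
    rcases List.mem_cons.1 hx with rfl | hx
    · exact hG l (by simp) b _ h.1
    · exact forall_lt_of_isWalk (fun l' hl' => hG l' (by simp [hl'])) h.2 x hx

/-- The walks through a row-bounded layered graph form a finite set. [folklore] -/
theorem finite_walks {n : ℕ} (G : List Layer) (hG : ∀ l ∈ G, ∀ x y, l.adj x y → y < n) (b : ℕ) :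
    {p : List ℕ | IsWalk G b p}.Finite := by
  refine (Set.finite_range (fun f : Fin G.length → Fin n => List.ofFn (fun i => (f i : ℕ)))).subset
    ?_
  intro p hp
  have hlen : p.length = G.length := hp.length_eq
  have hlt : ∀ x ∈ p, x < n := forall_lt_of_isWalk hG hp
  refine ⟨fun i => ⟨p[i.val]'(by rw [hlen]; exact i.isLt), hlt _ (List.getElem_mem _)⟩, ?_⟩
  apply List.ext_getElem
  · simp [hlen]
  · intro i h₁ h₂
    simp

/-- `UC` is finite. [folklore] -/
theorem finite_UC {n : ℕ} (G : List Layer) (hG : ∀ l ∈ G, ∀ x y, l.adj x y → y < n) (b e : ℕ) :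
    (UC G b e).Finite :=
  (finite_walks G hG b).subset fun _ hp => hp.1

/-- **Midpoint splitting.** A uniquely cheapest walk through `G₁ ++ G₂` is a uniquely cheapest walk
through `G₁` followed by a uniquely cheapest walk through `G₂`, both supported at the same
parameter. [folklore] -/
theorem UC_append_subset (G₁ G₂ : List Layer) (b e : ℕ) :
    UC (G₁ ++ G₂) b e ⊆ ⋃ r : ℕ, (fun pp : List ℕ × List ℕ => pp.1 ++ pp.2) ''
      {pp | pp.1 ∈ UC G₁ b r ∧ pp.2 ∈ UC G₂ r e ∧
        (cheapParams G₁ b r pp.1 ∩ cheapParams G₂ r e pp.2).Nonempty} := by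
  rintro p ⟨hw, hpe, t, ht⟩
  obtain ⟨p₁, p₂, rfl, hlen, hw₁, hw₂⟩ := isWalk_append_split hw
  refine Set.mem_iUnion.2 ⟨endpt b p₁, (p₁, p₂), ⟨⟨hw₁, rfl, t, ?_⟩, ⟨hw₂, ?_, t, ?_⟩, t, ?_, ?_⟩,
    rfl⟩
  -- `p₁` is uniquely cheapest at `t`
  · intro q₁ hq₁ hqe hne
    have hqlen : q₁.length = G₁.length := hq₁.length_eq
    have hq : IsWalk (G₁ ++ G₂) b (q₁ ++ p₂) := (isWalk_append hqlen).2 ⟨hq₁, by rw [hqe]; exact hw₂⟩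
    have hqend : endpt b (q₁ ++ p₂) = e := by rw [endpt_append, hqe, ← endpt_append]; exact hpe
    have hne' : q₁ ++ p₂ ≠ p₁ ++ p₂ := fun h => hne (List.append_cancel_right h)
    have h := ht _ hq hqend hne'
    rw [cost_append hlen, cost_append hqlen, hqe, eval_add, eval_add] at h
    linarith
  · rw [← endpt_append]; exact hpe
  -- `p₂` is uniquely cheapest at `t`
  · intro q₂ hq₂ hqe hne
    have hq : IsWalk (G₁ ++ G₂) b (p₁ ++ q₂) := (isWalk_append hlen).2 ⟨hw₁, hq₂⟩
    have hqend : endpt b (p₁ ++ q₂) = e := by rw [endpt_append]; exact hqe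
    have hne' : p₁ ++ q₂ ≠ p₁ ++ p₂ := fun h => hne (List.append_cancel_left h)
    have h := ht _ hq hqend hne'
    rw [cost_append hlen, cost_append hlen, eval_add, eval_add] at h
    linarith
  -- the common parameter, once more for each half
  · intro q₁ hq₁ hqe hne
    have hqlen : q₁.length = G₁.length := hq₁.length_eq
    have hq : IsWalk (G₁ ++ G₂) b (q₁ ++ p₂) := (isWalk_append hqlen).2 ⟨hq₁, by rw [hqe]; exact hw₂⟩
    have hqend : endpt b (q₁ ++ p₂) = e := by rw [endpt_append, hqe, ← endpt_append]; exact hpe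
    have hne' : q₁ ++ p₂ ≠ p₁ ++ p₂ := fun h => hne (List.append_cancel_right h)
    have h := ht _ hq hqend hne'
    rw [cost_append hlen, cost_append hqlen, hqe, eval_add, eval_add] at h
    linarith
  · intro q₂ hq₂ hqe hne
    have hq : IsWalk (G₁ ++ G₂) b (p₁ ++ q₂) := (isWalk_append hlen).2 ⟨hw₁, hq₂⟩
    have hqend : endpt b (p₁ ++ q₂) = e := by rw [endpt_append]; exact hqe
    have hne' : p₁ ++ q₂ ≠ p₁ ++ p₂ := fun h => hne (List.append_cancel_left h)
    have h := ht _ hq hqend hne'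
    rw [cost_append hlen, cost_append hlen, eval_add, eval_add] at h
    linarith

/-- The endpoint of a nonempty row sequence is one of its rows. [folklore] -/
theorem endpt_mem_of_ne_nil (b : ℕ) : ∀ (p : List ℕ), p ≠ [] → endpt b p ∈ p
  | [], h => (h rfl).elim
  | r :: rs, _ => by
    by_cases hrs : rs = []
    · subst hrs; simp
    · rw [endpt_cons]; exact List.mem_cons_of_mem _ (endpt_mem_of_ne_nil r rs hrs)

/-- Through a nonempty row-bounded graph every walk ends in a row `< n`. [folklore] -/
theorem endpt_lt {n : ℕ} {G : List Layer} {b : ℕ} {p : List ℕ}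
    (hG : ∀ l ∈ G, ∀ x y, l.adj x y → y < n) (hw : IsWalk G b p) (hne : G ≠ []) :
    endpt b p < n := by
  have hp : p ≠ [] := by
    rintro rfl
    have h := hw.length_eq
    rw [List.length_nil] at h
    exact hne (List.eq_nil_of_length_eq_zero h.symm)
  exact forall_lt_of_isWalk hG hw _ (endpt_mem_of_ne_nil b p hp)

/-- **Midpoint recursion, counting form**: `|UC(G₁ ++ G₂, b, e)| ≤ ∑_{r < n} (|UC(G₁, b, r)| +
|UC(G₂, r, e)|)` when the nonempty `G₁` and `G₂` enter only rows `< n` (for each middle row the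
two families of parameter intervals are pairwise disjoint: interval counting,
`ncard_meeting_pairs_le`). [folklore] -/
theorem ncard_UC_append_le {n : ℕ} (G₁ G₂ : List Layer) (hG₁ : ∀ l ∈ G₁, ∀ x y, l.adj x y → y < n)
    (hG₂ : ∀ l ∈ G₂, ∀ x y, l.adj x y → y < n) (hne : G₁ ≠ []) (b e : ℕ) :
    (UC (G₁ ++ G₂) b e).ncard ≤ ∑ r : Fin n, ((UC G₁ b r).ncard + (UC G₂ r e).ncard) := by
  classical
  set P : ℕ → Set (List ℕ × List ℕ) := fun r =>
    {pp | pp.1 ∈ UC G₁ b r ∧ pp.2 ∈ UC G₂ r e ∧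
      (cheapParams G₁ b r pp.1 ∩ cheapParams G₂ r e pp.2).Nonempty} with hP
  have hsub : UC (G₁ ++ G₂) b e ⊆
      ⋃ r : Fin n, (fun pp : List ℕ × List ℕ => pp.1 ++ pp.2) '' P r := by
    intro p hp
    obtain ⟨r, hr⟩ := Set.mem_iUnion.1 (UC_append_subset G₁ G₂ b e hp)
    obtain ⟨pp, hpp, rfl⟩ := hr
    have hrn : r < n := by
      have h := endpt_lt hG₁ hpp.1.1 hne
      rwa [hpp.1.2.1] at h
    exact Set.mem_iUnion.2 ⟨⟨r, hrn⟩, pp, hpp, rfl⟩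
  have hPfin : ∀ r, (P r).Finite := fun r =>
    ((finite_UC G₁ hG₁ b r).prod (finite_UC G₂ hG₂ r e)).subset fun pp hpp => ⟨hpp.1, hpp.2.1⟩
  calc (UC (G₁ ++ G₂) b e).ncard
      ≤ (⋃ r : Fin n, (fun pp : List ℕ × List ℕ => pp.1 ++ pp.2) '' P r).ncard :=
        Set.ncard_le_ncard hsub (Set.finite_iUnion fun r => (hPfin r).image _)
    _ ≤ ∑ r : Fin n, ((fun pp : List ℕ × List ℕ => pp.1 ++ pp.2) '' P r).ncard :=
        Set.ncard_iUnion_le_of_fintype _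
    _ ≤ ∑ r : Fin n, ((UC G₁ b r).ncard + (UC G₂ r e).ncard) := by
        refine Finset.sum_le_sum fun r _ => (Set.ncard_image_le (hPfin r)).trans ?_
        refine (HrubesYehudayoff2021Prop23.ncard_meeting_pairs_le (UC G₁ b r) (UC G₂ r e)
          (finite_UC G₁ hG₁ b r) (finite_UC G₂ hG₂ r e) (cheapParams G₁ b r) (cheapParams G₂ r e)
          (fun a _ => ordConnected_cheapParams G₁ b r a) (fun a _ => ordConnected_cheapParams G₂ r e a)
          (fun a ha a' ha' t ht ht' => cheapParams_disjoint G₁ b r ha ha' t ht ht')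
          (fun a ha a' ha' t ht ht' => cheapParams_disjoint G₂ r e ha ha' t ht ht')).trans ?_
        exact add_le_add
          (Set.ncard_le_ncard (fun a ha => ha.1) (finite_UC G₁ hG₁ b r))
          (Set.ncard_le_ncard (fun a ha => ha.1) (finite_UC G₂ hG₂ r e))

/-- Walks of length `≤ 1` with a common endpoint coincide. [folklore] -/
theorem eq_of_length_le_one {G : List Layer} {b : ℕ} {p p' : List ℕ} (hw : IsWalk G b p)
    (hw' : IsWalk G b p') (he : endpt b p = endpt b p') (hG : G.length ≤ 1) : p = p' := by
  have hl := hw.length_eq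
  have hl' := hw'.length_eq
  match p, p', hl, hl', he with
  | [], [], _, _, _ => rfl
  | [x], [y], _, _, he => simp only [endpt_cons, endpt_nil] at he; rw [he]
  | [], _ :: _, hl, hl', _ => simp at hl hl'; omega
  | _ :: _, [], hl, hl', _ => simp at hl hl'; omega
  | _ :: _ :: _, _, hl, _, _ => simp at hl; omega
  | _, _ :: _ :: _, _, hl', _ => simp at hl'; omega

/-- **Gusfield's cap** (parametric shortest paths in layered graphs, `n^{O(log m)}`): through a
layered graph with at most `2^k` layers entering only rows `< n` (`n ≥ 1`), at most `(2n)^k` of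
the `b → e` walks are ever the unique cheapest one. [folklore; Gusfield 1980, Carstensen 1983] -/
theorem ncard_UC_le {n : ℕ} (hn : 1 ≤ n) (k : ℕ) :
    ∀ (G : List Layer), (∀ l ∈ G, ∀ x y, l.adj x y → y < n) → G.length ≤ 2 ^ k →
      ∀ b e, (UC G b e).ncard ≤ (2 * n) ^ k := by
  induction k with
  | zero =>
    intro G hG hlen b e
    rw [pow_zero]
    exact (Set.ncard_le_one (finite_UC G hG b e)).2 fun p hp p' hp' =>
      eq_of_length_le_one hp.1 hp'.1 (hp.2.1.trans hp'.2.1.symm) (by simpa using hlen)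
  | succ k ih =>
    intro G hG hlen b e
    by_cases hsmall : G.length ≤ 2 ^ k
    · exact (ih G hG hsmall b e).trans (Nat.pow_le_pow_right (by omega) (by omega))
    · set G₁ := G.take (2 ^ k) with hG₁
      set G₂ := G.drop (2 ^ k) with hG₂
      have hsplit : G = G₁ ++ G₂ := (List.take_append_drop _ _).symm
      have hk : 1 ≤ 2 ^ k := Nat.one_le_two_pow
      have hl₁ : G₁.length = 2 ^ k := by rw [hG₁, List.length_take]; omega
      have hl₂ : G₂.length ≤ 2 ^ k := by rw [hG₂, List.length_drop, pow_succ] at *; omega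
      have hne : G₁ ≠ [] := fun h => by rw [h, List.length_nil] at hl₁; omega
      have hb₁ : ∀ l ∈ G₁, ∀ x y, l.adj x y → y < n := fun l hl => hG l (List.mem_of_mem_take hl)
      have hb₂ : ∀ l ∈ G₂, ∀ x y, l.adj x y → y < n := fun l hl => hG l (List.mem_of_mem_drop hl)
      rw [hsplit]
      refine (ncard_UC_append_le G₁ G₂ hb₁ hb₂ hne b e).trans ?_
      calc ∑ r : Fin n, ((UC G₁ b r).ncard + (UC G₂ r e).ncard)
          ≤ ∑ _r : Fin n, ((2 * n) ^ k + (2 * n) ^ k) :=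
            Finset.sum_le_sum fun r _ => add_le_add (ih G₁ hb₁ hl₁.le b r) (ih G₂ hb₂ hl₂ r e)
        _ = (2 * n) ^ (k + 1) := by
            rw [Finset.sum_const, Finset.card_univ, Fintype.card_fin, smul_eq_mul, pow_succ]; ring

/-! ## Point level: the shadow polygon of the path polytope of a layered graph

The planar image of the path polytope `conv{χ_p : p a b → e walk}` under the linear map sending the
arc `(x, layer i) → (y, layer i+1)` to the planar vector `w_i(x, y)` is the polygon spanned by the
cost points `cost G b p ∈ ℝ × ℝ`.  Uniquely supported cost points obey the same midpoint recursion
(the cost points of `G₁ ++ G₂` are the UNION over middle rows of MINKOWSKI SUMS of half cost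
points — HY21's two planar steps `um_iUnion_subset`, `ncard_um_add_le`), whence Gusfield's cap for
every pencil and, by the four-pencil lemma, for the vertex count of the polygon:
`σ(path polytope) ≤ 4·(2n)^k` — the upper half of HY21 Prop. 22 for arbitrary layered graphs. -/

section Points

local notation3 (prettyPrint := false) "UM[" c ", " d ", " X "]" =>
  {p | p ∈ X ∧ ∃ t : ℝ, ∀ q ∈ X, q ≠ p → c q + t * d q < c p + t * d p}

/-- The cost points of the `b → e` walks through `G`. [folklore] -/
def costPts (G : List Layer) (b e : ℕ) : Set (ℝ × ℝ) :=
  {x | ∃ p, IsWalk G b p ∧ endpt b p = e ∧ cost G b p = x}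

/-- Finitely many cost points. [folklore] -/
theorem finite_costPts {n : ℕ} (G : List Layer) (hG : ∀ l ∈ G, ∀ x y, l.adj x y → y < n)
    (b e : ℕ) : (costPts G b e).Finite :=
  ((finite_walks G hG b).image fun p => cost G b p).subset
    (by rintro x ⟨p, hw, -, rfl⟩; exact ⟨p, hw, rfl⟩)

/-- **Cost points split as a union of Minkowski sums** over the middle row (HY21: "`V = ⋃_S V_S`,
`conv V_S` a product"). [folklore] -/
theorem costPts_append_eq {n : ℕ} (G₁ G₂ : List Layer) (hG₁ : ∀ l ∈ G₁, ∀ x y, l.adj x y → y < n)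
    (hne : G₁ ≠ []) (b e : ℕ) :
    costPts (G₁ ++ G₂) b e = ⋃ r : Fin n, (costPts G₁ b r + costPts G₂ r e) := by
  ext x
  simp only [Set.mem_iUnion]
  constructor
  · rintro ⟨p, hw, he, rfl⟩
    obtain ⟨p₁, p₂, rfl, hlen, hw₁, hw₂⟩ := isWalk_append_split hw
    have hrn : endpt b p₁ < n := endpt_lt hG₁ hw₁ hne
    refine ⟨⟨endpt b p₁, hrn⟩, ?_⟩
    rw [cost_append hlen]
    exact Set.add_mem_add ⟨p₁, hw₁, rfl, rfl⟩ ⟨p₂, hw₂, by rw [← endpt_append]; exact he, rfl⟩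
  · rintro ⟨r, hx⟩
    obtain ⟨y, ⟨p₁, hw₁, he₁, rfl⟩, z, ⟨p₂, hw₂, he₂, rfl⟩, rfl⟩ := Set.mem_add.1 hx
    have hlen : p₁.length = G₁.length := hw₁.length_eq
    refine ⟨p₁ ++ p₂, (isWalk_append hlen).2 ⟨hw₁, by rw [he₁]; exact hw₂⟩, ?_, ?_⟩
    · rw [endpt_append, he₁]; exact he₂
    · rw [cost_append hlen, he₁]

/-- **Gusfield's cap, point level, for every pencil**: with at most `2^k` layers entering rows `< n`
(`n ≥ 1`), every pencil `c + t·d` supports uniquely at most `(2n)^k` cost points of `b → e` walks.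
[folklore; HY21 Prop. 22 upper half] -/
theorem ncard_um_costPts_le {n : ℕ} (hn : 1 ≤ n) (c d : ℝ × ℝ →+ ℝ) (k : ℕ) :
    ∀ (G : List Layer), (∀ l ∈ G, ∀ x y, l.adj x y → y < n) → G.length ≤ 2 ^ k →
      ∀ b e, (UM[c, d, costPts G b e]).ncard ≤ (2 * n) ^ k := by
  induction k with
  | zero =>
    intro G hG hlen b e
    rw [pow_zero]
    refine (Set.ncard_le_one ((finite_costPts G hG b e).subset fun x hx => hx.1)).2 ?_
    rintro x ⟨⟨p, hw, he, rfl⟩, -⟩ x' ⟨⟨p', hw', he', rfl⟩, -⟩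
    rw [eq_of_length_le_one hw hw' (he.trans he'.symm) (by simpa using hlen)]
  | succ k ih =>
    intro G hG hlen b e
    by_cases hsmall : G.length ≤ 2 ^ k
    · exact (ih G hG hsmall b e).trans (Nat.pow_le_pow_right (by omega) (by omega))
    · set G₁ := G.take (2 ^ k) with hG₁
      set G₂ := G.drop (2 ^ k) with hG₂
      have hsplit : G = G₁ ++ G₂ := (List.take_append_drop _ _).symm
      have hk : 1 ≤ 2 ^ k := Nat.one_le_two_pow
      have hl₁ : G₁.length = 2 ^ k := by rw [hG₁, List.length_take]; omega
      have hl₂ : G₂.length ≤ 2 ^ k := by rw [hG₂, List.length_drop, pow_succ] at *; omega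
      have hne : G₁ ≠ [] := fun h => by rw [h, List.length_nil] at hl₁; omega
      have hb₁ : ∀ l ∈ G₁, ∀ x y, l.adj x y → y < n := fun l hl => hG l (List.mem_of_mem_take hl)
      have hb₂ : ∀ l ∈ G₂, ∀ x y, l.adj x y → y < n := fun l hl => hG l (List.mem_of_mem_drop hl)
      rw [hsplit, costPts_append_eq G₁ G₂ hb₁ hne b e]
      refine (HrubesYehudayoff2021Prop23.ncard_um_iUnion_le c d
        (fun r : Fin n => costPts G₁ b r + costPts G₂ r e) fun r : Fin n =>
        (finite_costPts G₁ hb₁ b r).add (finite_costPts G₂ hb₂ r e)).trans ?_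
      calc ∑ r : Fin n, (UM[c, d, costPts G₁ b r + costPts G₂ r e]).ncard
          ≤ ∑ _r : Fin n, ((2 * n) ^ k + (2 * n) ^ k) :=
            Finset.sum_le_sum fun r _ =>
              (HrubesYehudayoff2021Prop23.ncard_um_add_le c d _ _ (finite_costPts G₁ hb₁ b r)
                (finite_costPts G₂ hb₂ r e)).trans
                (add_le_add (ih G₁ hb₁ hl₁.le b r) (ih G₂ hb₂ hl₂ r e))
        _ = (2 * n) ^ (k + 1) := by
            rw [Finset.sum_const, Finset.card_univ, Fintype.card_fin, smul_eq_mul, pow_succ]; ring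

/-- Uniquely supported points are transported by injective additive maps. [folklore] -/
theorem um_image_eq {V W : Type*} [AddCommGroup V] [AddCommGroup W] (φ : V →+ W)
    (hφ : Function.Injective φ) (c d : W →+ ℝ) (X : Set V) :
    UM[c, d, φ '' X] = φ '' UM[(c.comp φ), (d.comp φ), X] := by
  ext w
  constructor
  · rintro ⟨⟨x, hx, rfl⟩, t, ht⟩
    refine ⟨x, ⟨hx, t, fun q hq hne => ?_⟩, rfl⟩
    have h := ht (φ q) ⟨q, hq, rfl⟩ (fun h => hne (hφ h))
    simpa using h
  · rintro ⟨x, ⟨hx, t, ht⟩, rfl⟩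
    refine ⟨⟨x, hx, rfl⟩, t, ?_⟩
    rintro _ ⟨q, hq, rfl⟩ hne
    have h := ht q hq (fun h => hne (by rw [h]))
    simpa using h

/-- **Shadow polygon of the path polytope** (upper half of HY21 Prop. 22, every layered graph): the
polygon spanned by the cost points of the `b → e` walks — the planar shadow of the path polytope
under the arc-weight map — has at most `4·(2n)^k` vertices when the graph has at most `2^k` layers
entering rows `< n`.  (Stated in `Fin 2 → ℝ` through the linear identification with `ℝ × ℝ`.)
[folklore; HY21 Prop. 22] -/
theorem ncard_extremePoints_costPolygon_le {n : ℕ} (hn : 1 ≤ n) (k : ℕ) (G : List Layer)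
    (hG : ∀ l ∈ G, ∀ x y, l.adj x y → y < n) (hlen : G.length ≤ 2 ^ k) (b e : ℕ) :
    (Set.extremePoints ℝ (convexHull ℝ
      ((LinearEquiv.finTwoArrow ℝ ℝ).symm '' costPts G b e))).ncard ≤ 4 * (2 * n) ^ k := by
  set φ := (LinearEquiv.finTwoArrow ℝ ℝ).symm with hφ
  have hfin : (φ '' costPts G b e).Finite := (finite_costPts G hG b e).image _
  refine ncard_extremePoints_le_of_pencils _ hfin _ fun c d => ?_
  have hinj : Function.Injective (φ.toLinearMap.toAddMonoidHom) := φ.injective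
  have heq : (φ : ℝ × ℝ → Fin 2 → ℝ) '' costPts G b e =
      (φ.toLinearMap.toAddMonoidHom : ℝ × ℝ → Fin 2 → ℝ) '' costPts G b e := rfl
  rw [heq, um_image_eq φ.toLinearMap.toAddMonoidHom hinj c d (costPts G b e),
    Set.ncard_image_of_injective _ hinj]
  exact ncard_um_costPts_le hn _ _ k G hG hlen b e

end Points

end Summit.ValiantsHypothesis.Theorems.ShadowBirkhoffNegative

end
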